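import Summits.ResolutionOfSingularities.ResolutionOfSingularities.Theorems.WeightedInvariantKWildHomSlotNakayama
import Summits.ResolutionOfSingularities.ResolutionOfSingularities.Theorems.WeightedInvariantKWildHomSlotSplit
import Summits.ResolutionOfSingularities.ResolutionOfSingularities.Theorems.WeightedInvariantKWildHomSlotReplace
import Summits.ResolutionOfSingularities.ResolutionOfSingularities.Theorems.WeightedInvariantHypersurfaceCentreAssemblyGlue
import Summits.ResolutionOfSingularities.ResolutionOfSingularities.Theorems.MarkedTransferCampaignW46MohWindowSurfaceLocal
import Summits.ResolutionOfSingularities.ResolutionOfSingularities.Theorems.WeightedInvariantIota3FlagBridge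
import Summits.ResolutionOfSingularities.ResolutionOfSingularities.Theorems.WeightedInvariantKWildHomDrop
import HarnessLib

/-!
# (H3) of (K-wild-hom): σ-MAXIMISING TWO-FLAGS CAN BE TAKEN AMONG ANY GENERATING CLASS OF THE WEIGHTED FILTRATION —
# in particular T-HOMOGENEOUS, given (H2) «every piece `J_m` is the extension of a T-homogeneous ideal»

Route `ResolutionOfSingularities/WeightedInvariant`, door crux `HypersurfaceCentreConstruction` (stmt-ResolutionOfSingularities-19897), P3 rung;
ORDER (o50) of res-L1-w43-plan-1, kernel item (H3) of the memo `plan/tools/res-type-060/o50/K-WILD-HOM.md` §2 (design of record, RULING gen 11 #9);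
res-type-060 (gen 10).  [OURS · L1 W4.3 · helper, counted 0] — pure local algebra on top of step 1 (`…KWildHomSlotNakayama`), step 2a
(`…KWildHomSlotSplit`), step 2b (`…KWildHomSlotReplace`), the r.s.p. minimality `CampaignW46.MohWindowSurface.not_mem_span_pair_sup_sq` and
res-type-070's bridge `Iota3.flagContactFiltration_eq_weightedMonomialIdeal`.  AI proof, weaker than expert review.

## Content

§1 One slot (any local ring, any number of slots): `KWildHom.not_mem_update_zero_sup_mul` — a slot `uₗ` of positive weight that is a minimal generator
modulo the other slots (`uₗ ∉ P + 𝔪²`, `P ∋ uᵢ (i ≠ l)`) is not in `J_{wₗ}(u[l ↦ 0]) + 𝔪·J_{wₗ}(u)`; `KWildHom.exists_mem_slot_replace` — hence for ANY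
generating set `H` of `J_{wₗ}(u)` some `h ∈ H` replaces `uₗ` keeping the whole weighted filtration, with `uₗ ∈ (h) + P` and `h ∈ 𝔪`.

§2 Three slots (regular local ring of embedding dimension `3`, `𝔪 = (x, g₂, g₁)`, weights `(q, r₂, r₁)` admissible):
`KWildHom.exists_sigmaMaximiser_mem_of_span_eq` — if every piece `J_m(x, g₂, g₁)` is generated by a subset of a class `H ⊆ R`, then a σ-maximising
two-flag `(g₁, g₂; q, r₁, r₂)` of `f` completed by `x` can be replaced by one with ALL THREE members in `H`, the same regular system property, the same
`IsSigmaMaximiser` letters and the same weighted filtration.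

§3 At a prime of any ring (`KWildHom.exists_sigmaMaximiser_of_map_eq`, `H` = images of a class `Hom ⊆ B` such that each `J_m` is the extension of an
ideal generated by its members in `Hom`; the new members are images of elements of `Hom ∩ 𝔫`) and the memo's form
`KWildHom.exists_homogeneous_sigmaMaximiser` for the cobordant algebra `B = cobordantAlgebra' u w` with its `T`-grading (p539199) and (H2) stated through
`IsTHomogeneous` (p540275): **σ-maximising flags at a T-homogeneous prime can be taken T-homogeneous.**  What remains of (o50) after this file is (K) itself
(res-type-073's (K1)(K2) in the bigraded ring; ruled to the res-type-073 successor / res-type-061 g16).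
-/

set_option linter.dupNamespace false -- mandated namespace of this single-conjunct summit

namespace Summit.ResolutionOfSingularities.ResolutionOfSingularities.Theorems

namespace KWildHom

open IsLocalRing Literature.AlgebraicGeometry.Resolution
open Summit.ResolutionOfSingularities.ResolutionOfSingularities.Cruxes.HypersurfaceCentreConstruction.LocalEngine

/-! ## §1 One slot -/

section OneSlot

variable {A : Type*} [CommRing A] {m : ℕ}

/-- The monomials avoiding the slot `l`, in positive degree, lie in any ideal containing the other slots. [cite: Wlodarczyk2022, 2.1.10] -/
theorem weightedMonomialIdeal_update_zero_le_of_forall_mem (u : Fin m → A) (w : Fin m → ℕ) (l : Fin m) {P : Ideal A}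
    (hP : ∀ i, i ≠ l → u i ∈ P) {n : ℕ} (hn : 0 < n) : weightedMonomialIdeal (Function.update u l 0) w n ≤ P :=
  weightedMonomialIdeal_le_of_forall_mem_of_pos _ w (P := P) (fun i => by
    by_cases hi : i = l
    · subst hi; rw [Function.update_self]; exact P.zero_mem
    · rw [Function.update_of_ne hi]; exact hP i hi) hn

/-- **A minimal slot is a minimal generator of its piece**: if `uₗ ∉ P + 𝔪²` where `P` contains the other slots and `𝔪` all of them, and
`0 < wₗ`, then `uₗ ∉ J_{wₗ}(u[l ↦ 0]) + 𝔪·J_{wₗ}(u)`. [OURS · L1 W4.3] -/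
theorem not_mem_update_zero_sup_mul (u : Fin m → A) (w : Fin m → ℕ) (l : Fin m) {𝔪 P : Ideal A} (hu : ∀ i, u i ∈ 𝔪)
    (hP : ∀ i, i ≠ l → u i ∈ P) (hw : 0 < w l) (hmin : u l ∉ P ⊔ 𝔪 ^ 2) :
    u l ∉ weightedMonomialIdeal (Function.update u l 0) w (w l) ⊔ 𝔪 * weightedMonomialIdeal u w (w l) := by
  have hJ : 𝔪 * weightedMonomialIdeal u w (w l) ≤ 𝔪 ^ 2 := by
    rw [pow_two]
    exact Ideal.mul_mono_right (weightedMonomialIdeal_le_of_forall_mem_of_pos u w hu hw)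
  exact fun hmem => hmin (sup_le_sup (weightedMonomialIdeal_update_zero_le_of_forall_mem u w l hP hw) hJ hmem)

variable {R : Type*} [CommRing R] [IsLocalRing R]

/-- **ONE-SLOT REPLACEMENT inside a generating class.**  Local ring, slots `u` in `𝔪`, slot `l` of positive weight minimal modulo the others
(`uₗ ∉ P + 𝔪²`), `H` ANY generating set of the piece `J_{wₗ}(u)`: some `h ∈ H` replaces `uₗ` — `J_n(u[l ↦ h]) = J_n(u)` for all `n` — with
`h ∈ 𝔪` and `uₗ ∈ (h) + P` (so the slots still generate the same ideal). [OURS · L1 W4.3] -/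
theorem exists_mem_slot_replace (u : Fin m → R) (w : Fin m → ℕ) (l : Fin m) {P : Ideal R} (hu : ∀ i, u i ∈ maximalIdeal R)
    (hP : ∀ i, i ≠ l → u i ∈ P) (hw : 0 < w l) (hmin : u l ∉ P ⊔ maximalIdeal R ^ 2) {H : Set R}
    (hH : Ideal.span H = weightedMonomialIdeal u w (w l)) :
    ∃ h ∈ H, h ∈ maximalIdeal R ∧ u l ∈ Ideal.span {h} ⊔ P ∧
      ∀ n, weightedMonomialIdeal (Function.update u l h) w n = weightedMonomialIdeal u w n := by
  obtain ⟨h, hhH, c, hc, hmem⟩ := exists_unit_mul_sub_mem_of_span_eq (weightedMonomialIdeal_weight_eq_span_sup u w l)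
    (not_mem_update_zero_sup_mul u w l hu hP hw hmin) hH
  have hhJ : h ∈ weightedMonomialIdeal u w (w l) := hH ▸ Ideal.subset_span hhH
  refine ⟨h, hhH, weightedMonomialIdeal_le_of_forall_mem_of_pos u w hu hw hhJ, ?_,
    weightedMonomialIdeal_update_eq_of_unit_mul_sub_mem u w l hc hmem hhJ⟩
  have hsplit : u l = c * h + (u l - c * h) := by ring
  rw [hsplit]
  exact Ideal.add_mem _ (Ideal.mem_sup_left (Ideal.mul_mem_left _ _ (Ideal.mem_span_singleton_self h)))
    (Ideal.mem_sup_right (weightedMonomialIdeal_update_zero_le_of_forall_mem u w l hP hw hmem))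

end OneSlot

/-! ## §2 Three slots: σ-maximising flags inside a generating class -/

section Vec

variable {R : Type*}

/-- `u[2 ↦ d] = (u₀, u₁, d)` on `Fin 3`. [folklore] -/
theorem update_vec₃_two (a b c d : R) : Function.update ![a, b, c] 2 d = ![a, b, d] := by
  ext i; fin_cases i <;> simp

/-- `u[1 ↦ d] = (u₀, d, u₂)` on `Fin 3`. [folklore] -/
theorem update_vec₃_one (a b c d : R) : Function.update ![a, b, c] 1 d = ![a, d, c] := by
  ext i; fin_cases i <;> simp

/-- `u[0 ↦ d] = (d, u₁, u₂)` on `Fin 3`. [folklore] -/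
theorem update_vec₃_zero (a b c d : R) : Function.update ![a, b, c] 0 d = ![d, b, c] := by
  ext i; fin_cases i <;> simp

end Vec

section ThreeSlots

variable {R : Type} [CommRing R] [IsRegularLocalRing R]

/-- If `𝔪 = (a, b, c)` then every slot is in `𝔪`. [folklore] -/
theorem forall_vec₃_mem_of_span_eq {a b c : R} (h : Ideal.span {a, b, c} = maximalIdeal R) (i : Fin 3) :
    ![a, b, c] i ∈ maximalIdeal R := by
  rw [← h]
  fin_cases i <;> exact Ideal.subset_span (by simp)

/-- New span after a slot replacement: if `𝔪 = (a, b, c)`, `c ∈ (h) + (a, b)` and `h ∈ 𝔪` then `𝔪 = (a, b, h)`. [folklore] -/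
theorem span_triple_eq_of_mem_sup {a b c h : R} (hspan : Ideal.span {a, b, c} = maximalIdeal R)
    (hc : c ∈ Ideal.span {h} ⊔ Ideal.span {a, b}) (hh : h ∈ maximalIdeal R) : Ideal.span {a, b, h} = maximalIdeal R := by
  refine le_antisymm ?_ ?_
  · rw [Ideal.span_le]
    have ha : a ∈ maximalIdeal R := hspan ▸ Ideal.subset_span (by simp)
    have hb : b ∈ maximalIdeal R := hspan ▸ Ideal.subset_span (by simp)
    rintro t (rfl | rfl | rfl)
    · exact ha
    · exact hb
    · exact hh
  · rw [← hspan, Ideal.span_le]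
    have ha : a ∈ Ideal.span ({a, b, h} : Set R) := Ideal.subset_span (by simp)
    have hb : b ∈ Ideal.span ({a, b, h} : Set R) := Ideal.subset_span (by simp)
    have hh' : h ∈ Ideal.span ({a, b, h} : Set R) := Ideal.subset_span (by simp)
    rintro t (rfl | rfl | rfl)
    · exact ha
    · exact hb
    · refine (sup_le ((Ideal.span_singleton_le_iff_mem _).mpr hh') ?_) hc
      rw [Ideal.span_le]
      rintro s (rfl | rfl)
      · exact ha
      · exact hb

/-- **σ-MAXIMISING FLAGS INSIDE A GENERATING CLASS.**  `R` regular local of embedding dimension `3`, `𝔪 = (x, g₂, g₁)`,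
`(g₁, g₂; q, r₁, r₂)` a σ-maximising two-flag of `f` (order `ν`), and `H ⊆ R` a class such that every piece `J_m(x, g₂, g₁; q, r₂, r₁)` is
generated by some subset of `H`.  Then there are `x', g₁', g₂' ∈ H` with `𝔪 = (x', g₂', g₁')`, `(g₁', g₂'; q, r₁, r₂)` again σ-maximising for `f`,
and the same weighted filtration.  (Slot by slot: `exists_mem_slot_replace` with the r.s.p. minimality `not_mem_span_pair_sup_sq`; the letters of
`IsSigmaMaximiser` transfer through res-type-070's bridge `flagContactFiltration = weightedMonomialIdeal`.) [OURS · L1 W4.3] -/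
theorem exists_sigmaMaximiser_mem_of_span_eq (h3 : (maximalIdeal R).spanFinrank = 3) {f : R} {ν : ℕ} {x g₁ g₂ : R}
    {q r₁ r₂ : ℕ} (hspan : Ideal.span {x, g₂, g₁} = maximalIdeal R) (hmax : Iota3.IsSigmaMaximiser f ν g₁ g₂ q r₁ r₂) {H : Set R}
    (hH : ∀ m, ∃ Hm ⊆ H, Ideal.span Hm = weightedMonomialIdeal ![x, g₂, g₁] ![q, r₂, r₁] m) :
    ∃ x' g₁' g₂' : R, x' ∈ H ∧ g₁' ∈ H ∧ g₂' ∈ H ∧ Ideal.span {x', g₂', g₁'} = maximalIdeal R ∧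
      Iota3.IsSigmaMaximiser f ν g₁' g₂' q r₁ r₂ ∧
      ∀ m, weightedMonomialIdeal ![x', g₂', g₁'] ![q, r₂, r₁] m = weightedMonomialIdeal ![x, g₂, g₁] ![q, r₂, r₁] m := by
  obtain ⟨⟨hq, hq₂, hr⟩, -, hf, hmax'⟩ := hmax
  have hq₁ : q ≤ r₁ := hq₂.trans hr
  set w : Fin 3 → ℕ := ![q, r₂, r₁] with hw
  -- slot 2 (`g₁`, weight `r₁`)
  obtain ⟨H₂, hH₂H, hH₂⟩ := hH r₁
  obtain ⟨h₁, hh₁H, hh₁𝔪, hg₁, hfilt₁⟩ := exists_mem_slot_replace ![x, g₂, g₁] w 2 (P := Ideal.span {x, g₂})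
    (forall_vec₃_mem_of_span_eq hspan) (fun i hi => by
      fin_cases i
      · exact Ideal.subset_span (by simp)
      · exact Ideal.subset_span (by simp)
      · exact absurd rfl hi) (hq.trans_le hq₁)
    (by simpa using CampaignW46.MohWindowSurface.not_mem_span_pair_sup_sq h3 hspan) (H := H₂) (by simpa [hw] using hH₂)
  rw [update_vec₃_two] at hfilt₁
  have hspan₁ : Ideal.span {x, g₂, h₁} = maximalIdeal R := span_triple_eq_of_mem_sup hspan (by simpa using hg₁) hh₁𝔪
  -- slot 1 (`g₂`, weight `r₂`)
  obtain ⟨H₁, hH₁H, hH₁⟩ := hH r₂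
  have hspan₁' : Ideal.span {x, h₁, g₂} = maximalIdeal R := by rw [← hspan₁, Set.pair_comm]
  obtain ⟨h₂, hh₂H, hh₂𝔪, hg₂, hfilt₂⟩ := exists_mem_slot_replace ![x, g₂, h₁] w 1 (P := Ideal.span {x, h₁})
    (forall_vec₃_mem_of_span_eq hspan₁) (fun i hi => by
      fin_cases i
      · exact Ideal.subset_span (by simp)
      · exact absurd rfl hi
      · exact Ideal.subset_span (by simp)) (hq.trans_le hq₂)
    (by simpa using CampaignW46.MohWindowSurface.not_mem_span_pair_sup_sq h3 hspan₁') (H := H₁)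
    (by rw [hfilt₁]; simpa [hw] using hH₁)
  rw [update_vec₃_one] at hfilt₂
  have hspan₂ : Ideal.span {x, h₂, h₁} = maximalIdeal R := by
    have := span_triple_eq_of_mem_sup hspan₁' (by simpa using hg₂) hh₂𝔪
    rw [← this, Set.pair_comm]
  -- slot 0 (`x`, weight `q`)
  obtain ⟨H₀, hH₀H, hH₀⟩ := hH q
  have hspan₂' : Ideal.span {h₂, h₁, x} = maximalIdeal R := by
    rw [← hspan₂]
    congr 1
    ext t
    simp only [Set.mem_insert_iff, Set.mem_singleton_iff]
    tauto
  obtain ⟨h₀, hh₀H, hh₀𝔪, hx, hfilt₃⟩ := exists_mem_slot_replace ![x, h₂, h₁] w 0 (P := Ideal.span {h₂, h₁})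
    (forall_vec₃_mem_of_span_eq hspan₂) (fun i hi => by
      fin_cases i
      · exact absurd rfl hi
      · exact Ideal.subset_span (by simp)
      · exact Ideal.subset_span (by simp)) hq
    (by simpa using CampaignW46.MohWindowSurface.not_mem_span_pair_sup_sq h3 hspan₂') (H := H₀)
    (by rw [hfilt₂, hfilt₁]; simpa [hw] using hH₀)
  rw [update_vec₃_zero] at hfilt₃
  have hspan₃ : Ideal.span {h₀, h₂, h₁} = maximalIdeal R := by
    have := span_triple_eq_of_mem_sup hspan₂' (by simpa using hx) hh₀𝔪
    rw [← this]
    congr 1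
    ext t
    simp only [Set.mem_insert_iff, Set.mem_singleton_iff]
    tauto
  have hfilt : ∀ m, weightedMonomialIdeal ![h₀, h₂, h₁] w m = weightedMonomialIdeal ![x, g₂, g₁] w m := fun m => by
    rw [hfilt₃, hfilt₂, hfilt₁]
  refine ⟨h₀, h₁, h₂, hH₀H hh₀H, hH₂H hh₁H, hH₁H hh₂H, hspan₃, ⟨⟨hq, hq₂, hr⟩, ?_, ?_, hmax'⟩, hfilt⟩
  · -- the new pair is a two-flag (members `2`, `1` of the regular system `(h₀, h₂, h₁)`)
    have hv : Ideal.span (Set.range ![h₀, h₂, h₁]) = maximalIdeal R := by rw [Iota3.range_vec₃, hspan₃]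
    simpa using Iota3.isTwoFlag_of_rsp h3 ![h₀, h₂, h₁] hv (i := 2) (j := 1) (by decide)
  · rw [Iota3.flagContactFiltration_eq_weightedMonomialIdeal hspan₃ hq hq₂ hq₁, hfilt,
      ← Iota3.flagContactFiltration_eq_weightedMonomialIdeal hspan hq hq₂ hq₁]
    exact hf

end ThreeSlots

/-! ## §3 At a prime: generators from a class of the big ring; the T-homogeneous form -/

section AtPrime

variable {B : Type} [CommRing B]

/-- **σ-MAXIMISING FLAGS FROM A CLASS OF THE GLOBAL RING.**  `𝔫` a prime of `B` with `R = B_𝔫` regular of embedding dimension `3`,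
`𝔪_R = (x, g₂, g₁)`, `(g₁, g₂; q, r₁, r₂)` σ-maximising for `f ∈ R`, and `Hom ⊆ B` a class such that every piece `J_m` is the extension of an
ideal of `B` generated by its members in `Hom` (hypothesis (H2) of the memo, e.g. `Hom` = homogeneous elements and `J_m` extended from homogeneous
ideals).  Then the flag and its completing parameter can be taken to be images of elements of `Hom ∩ 𝔫`, with the same letters and the same
filtration. [OURS · L1 W4.3] -/
theorem exists_sigmaMaximiser_of_map_eq (Hom : Set B) (𝔫 : Ideal B) [𝔫.IsPrime]
    [IsRegularLocalRing (Localization.AtPrime 𝔫)] (h3 : (maximalIdeal (Localization.AtPrime 𝔫)).spanFinrank = 3)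
    {f : Localization.AtPrime 𝔫} {ν : ℕ} {x g₁ g₂ : Localization.AtPrime 𝔫} {q r₁ r₂ : ℕ}
    (hspan : Ideal.span {x, g₂, g₁} = maximalIdeal (Localization.AtPrime 𝔫))
    (hmax : Iota3.IsSigmaMaximiser f ν g₁ g₂ q r₁ r₂)
    (hJ : ∀ m, ∃ I : Ideal B, Ideal.span (Hom ∩ I) = I ∧
      I.map (algebraMap B (Localization.AtPrime 𝔫)) = weightedMonomialIdeal ![x, g₂, g₁] ![q, r₂, r₁] m) :
    ∃ x' g₁' g₂' : B, x' ∈ Hom ∧ g₁' ∈ Hom ∧ g₂' ∈ Hom ∧ x' ∈ 𝔫 ∧ g₁' ∈ 𝔫 ∧ g₂' ∈ 𝔫 ∧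
      Ideal.span {algebraMap B (Localization.AtPrime 𝔫) x', algebraMap B _ g₂', algebraMap B _ g₁'} = maximalIdeal _ ∧
      Iota3.IsSigmaMaximiser f ν (algebraMap B (Localization.AtPrime 𝔫) g₁') (algebraMap B _ g₂') q r₁ r₂ ∧
      ∀ m, weightedMonomialIdeal ![algebraMap B (Localization.AtPrime 𝔫) x', algebraMap B _ g₂', algebraMap B _ g₁'] ![q, r₂, r₁] m =
        weightedMonomialIdeal ![x, g₂, g₁] ![q, r₂, r₁] m := by
  set φ := algebraMap B (Localization.AtPrime 𝔫) with hφ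
  have hH : ∀ m, ∃ Hm ⊆ φ '' Hom, Ideal.span Hm = weightedMonomialIdeal ![x, g₂, g₁] ![q, r₂, r₁] m := fun m => by
    obtain ⟨I, hI, hIJ⟩ := hJ m
    refine ⟨φ '' (Hom ∩ I), Set.image_mono Set.inter_subset_left, ?_⟩
    rw [← Ideal.map_span, hI, hIJ]
  obtain ⟨x', g₁', g₂', ⟨bx, hbx, rfl⟩, ⟨b₁, hb₁, rfl⟩, ⟨b₂, hb₂, rfl⟩, hspan', hmax', hfilt⟩ :=
    exists_sigmaMaximiser_mem_of_span_eq h3 hspan hmax hH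
  have hmem : ∀ b : B, φ b ∈ Ideal.span ({φ bx, φ b₂, φ b₁} : Set _) → b ∈ 𝔫 := fun b hb => by
    rw [hspan'] at hb
    exact (IsLocalization.AtPrime.to_map_mem_maximal_iff (Localization.AtPrime 𝔫) 𝔫 b).mp hb
  exact ⟨bx, b₁, b₂, hbx, hb₁, hb₂, hmem bx (Ideal.subset_span (by simp)), hmem b₁ (Ideal.subset_span (by simp)),
    hmem b₂ (Ideal.subset_span (by simp)), hspan', hmax', hfilt⟩

end AtPrime

section Homogeneous

variable {S : Type} [CommRing S] {n : ℕ} (u : Fin n → S) (w : Fin n → ℕ)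

/-- **(H3) σ-MAXIMISING FLAGS CAN BE TAKEN T-HOMOGENEOUS** (memo K-WILD-HOM §2).  In the cobordant algebra `B = cobordantAlgebra' u w` with its
`T`-grading, at a prime `𝔫` with `B_𝔫` regular of embedding dimension `3` and `𝔪 = (x, g₂, g₁)`: if `(g₁, g₂; q, r₁, r₂)` is σ-maximising for `f`
and every piece `J_m(x, g₂, g₁; q, r₂, r₁)` is the extension of a T-HOMOGENEOUS ideal of `B` (hypothesis (H2) = [S5] read at `B`), then there is a
σ-maximising flag with the same letters, the same filtration and a completing parameter, all three images of T-HOMOGENEOUS elements of `𝔫`.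
(FALSE without (H2) in general — a non-T-stable filtration has no homogeneous generators; under [S5] that falsifier cannot occur.) [OURS · L1 W4.3] -/
theorem exists_homogeneous_sigmaMaximiser (𝔫 : Ideal (cobordantAlgebra' u w)) [𝔫.IsPrime]
    [IsRegularLocalRing (Localization.AtPrime 𝔫)] (h3 : (maximalIdeal (Localization.AtPrime 𝔫)).spanFinrank = 3)
    {f : Localization.AtPrime 𝔫} {ν : ℕ} {x g₁ g₂ : Localization.AtPrime 𝔫} {q r₁ r₂ : ℕ}
    (hspan : Ideal.span {x, g₂, g₁} = maximalIdeal (Localization.AtPrime 𝔫))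
    (hmax : Iota3.IsSigmaMaximiser f ν g₁ g₂ q r₁ r₂)
    (hJhom : ∀ m, ∃ I : Ideal (cobordantAlgebra' u w), IsTHomogeneous u w I ∧
      I.map (algebraMap _ (Localization.AtPrime 𝔫)) = weightedMonomialIdeal ![x, g₂, g₁] ![q, r₂, r₁] m) :
    ∃ x' g₁' g₂' : cobordantAlgebra' u w,
      SetLike.IsHomogeneousElem (KWildHom.tGrading u w) x' ∧ SetLike.IsHomogeneousElem (KWildHom.tGrading u w) g₁' ∧
      SetLike.IsHomogeneousElem (KWildHom.tGrading u w) g₂' ∧ x' ∈ 𝔫 ∧ g₁' ∈ 𝔫 ∧ g₂' ∈ 𝔫 ∧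
      Ideal.span {algebraMap _ (Localization.AtPrime 𝔫) x', algebraMap _ _ g₂', algebraMap _ _ g₁'} = maximalIdeal _ ∧
      Iota3.IsSigmaMaximiser f ν (algebraMap _ (Localization.AtPrime 𝔫) g₁') (algebraMap _ _ g₂') q r₁ r₂ ∧
      ∀ m, weightedMonomialIdeal ![algebraMap _ (Localization.AtPrime 𝔫) x', algebraMap _ _ g₂', algebraMap _ _ g₁'] ![q, r₂, r₁] m =
        weightedMonomialIdeal ![x, g₂, g₁] ![q, r₂, r₁] m := by
  have hJ : ∀ m, ∃ I : Ideal (cobordantAlgebra' u w),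
      Ideal.span ({b | SetLike.IsHomogeneousElem (KWildHom.tGrading u w) b} ∩ (I : Set (cobordantAlgebra' u w))) = I ∧
      I.map (algebraMap _ (Localization.AtPrime 𝔫)) = weightedMonomialIdeal ![x, g₂, g₁] ![q, r₂, r₁] m := fun m => by
    obtain ⟨I, hI, hIJ⟩ := hJhom m
    refine ⟨I, ?_, hIJ⟩
    have hset : {b | SetLike.IsHomogeneousElem (KWildHom.tGrading u w) b} ∩ (I : Set (cobordantAlgebra' u w)) =
        {b | b ∈ I ∧ SetLike.IsHomogeneousElem (KWildHom.tGrading u w) b} := by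
      ext b
      simp only [Set.mem_inter_iff, Set.mem_setOf_eq, SetLike.mem_coe]
      tauto
    rw [hset]
    exact hI
  obtain ⟨x', g₁', g₂', hx', hg₁', hg₂', hrest⟩ :=
    exists_sigmaMaximiser_of_map_eq {b | SetLike.IsHomogeneousElem (KWildHom.tGrading u w) b} 𝔫 h3 hspan hmax hJ
  exact ⟨x', g₁', g₂', hx', hg₁', hg₂', hrest⟩

end Homogeneous

end KWildHom

end Summit.ResolutionOfSingularities.ResolutionOfSingularities.Theorems
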